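import Literature.NumberTheory.Automorphic.IntegralEigenclassHeckePoint
import Literature.NumberTheory.Automorphic.TwistedQuotientLevelProdSemilinear
import HarnessLib

/-!
# Nilpotent control of Hecke polynomials on `H^q(Γ, W^{L/L'})` by the trivial-coefficient pieces,
# for a general reduced datum `W = Fun(𝒢 ⧸ L', N)`

Topic `NumberTheory/Automorphic`; namespace `Literature.NumberTheory.Automorphic.TwistedQuotient`.
Theorems only; no definition, no named fact, no instance, no `sorry`.

`IntegralEigenclassHeckePoint.nilpotentControl_at_level` proves, INSIDE an existential package, that
a noncommutative polynomial `P` in the Hecke operators which kills the pieces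
`H^b(X_{L'}, k/p^{t'})`, `b ≤ q`, of a level tower acts with vanishing `(q+1)`-st power on
`H^q(Γ, W^{L/L'})`, where `W = Fun(𝒢 ⧸ L', M/p^{t'})` is the reduction of the integral structure of a
lattice `M`.  The argument only uses that the values module is free of finite rank over
`k/p^{t'}`.  Here it is extracted for a GENERAL `W = oneProdTwist ι hle σ` — values `N` with any
representation `σ` of `L ⧸ L'` and an identification `eN : N ≃ (k/p^{t'})^d` — with the Hecke
operators `heckeProdTwistHom` and EXPLICIT conclusion
(`pow_succ_lift_φZ_heckeProdTwist_eq_zero`): this is the form needed to run the control over the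
big coefficient ring `ℤ̄_p` on a datum transported from a Noetherian subring (the values
`(ℤ̄_p/p^{t'})^d` are not the reduction of a `ℤ̄_p`-lattice one has finiteness for), cf.
`TwistedQuotientLevelProdSemilinear`, `…ScalarDescent`, `…Retraction`.
[Scholze2015, §V.4, proof of Thm. V.4.1: the Hochschild–Serre argument.]

## References

* P. Scholze, *On torsion in the cohomology of locally symmetric varieties*, Ann. of Math. 182
  (2015), §V.4, proof of Thm. V.4.1. [Scholze2015]
-/

noncomputable section

open CategoryTheory Literature.Algebra.Homology
open scoped Classical

universe u v

namespace Literature.NumberTheory.Automorphic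

namespace TwistedQuotient

open IntegralEigenclass

variable {k : Type u} [CommRing k] {Γ 𝒢 : Type u} [Group Γ] [Group 𝒢] (ι : Γ →* 𝒢)
  (T : LevelTower 𝒢) (p : ℕ) {L : Subgroup 𝒢} (r : ℕ) (hle : T.level r ≤ L)
  [hN : ((T.level r).subgroupOf L).Normal]
  {N : Type u} [AddCommGroup N] [Module k N]
  (σ : Representation k (L ⧸ (T.level r).subgroupOf L) N)
  {J : Type v} (δ : J → 𝒢)
  (hconj : ∀ (j : J) (l : L), ∃ a ∈ T.level r, ∃ b ∈ T.level r,
    (l : 𝒢) * δ j * (l : 𝒢)⁻¹ = a * δ j * b)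
  (hfin' : ∀ j, (ArithmeticQuotient.doubleCosetQuot (T.level r) (δ j)).Finite)

/-- **Nilpotent control, explicit form.**  Let `W = Fun(𝒢 ⧸ L', N)` (`L' = T.level r`, `Γ` by
left translation, `L ⧸ L'` through `σ`) with `N ≃ (k/p^{t'})^d`, and let `S_j` be the operator
induced on `H^q(Γ, W^{L/L'})` by the Hecke operator `[L' δ_j L']` of `W`.  If a noncommutative
polynomial `P` in the tower Hecke operators `T_{δ_j}` vanishes on the pieces
`H^b(X_{L'}, k/p^{t'})`, `b ≤ q`, then `P(S)^{q+1} = 0`.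
[cite: Scholze2015, §V.4, proof of Thm. V.4.1] -/
theorem pow_succ_lift_φZ_heckeProdTwist_eq_zero (t' : ℕ) {d : ℕ}
    (eN : N ≃ₗ[k] (Fin d → modPow k (p : k) t')) (q : ℕ) (P : FreeAlgebra k J)
    (hP : ∀ b ≤ q,
      FreeAlgebra.lift k (fun j => towerHeckeFamily k ι T (p : k) (δ j)) P (b, r, t') = 0) :
    (FreeAlgebra.lift k (fun j => (groupCohomology.map (MonoidHom.id Γ)
        (A := hKerRep (oneProdTwist ι hle σ) 0) (B := hKerRep (oneProdTwist ι hle σ) 0)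
        (φZ (oneProdTwist ι hle σ) (heckeProdTwistHom ι hle (1 : Representation k Γ N) σ
          (commute_one σ) (hconj j) (hfin' j)) 0) q).hom) P) ^ (q + 1) = 0 := by
  classical
  -- notation
  let W := oneProdTwist ι hle σ
  let hPTH : J → End W := fun j =>
    heckeProdTwistHom ι hle (1 : Representation k Γ N) σ (commute_one σ) (hconj j) (hfin' j)
  let S : J → Module.End k (groupCohomology (hKerRep W 0) q) := fun j =>
    (groupCohomology.map (MonoidHom.id Γ) (A := hKerRep W 0) (B := hKerRep W 0)
      (φZ W (hPTH j) 0) q).hom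
  change (FreeAlgebra.lift k S P) ^ (q + 1) = 0
  -- `P(S) = H^q(φZ (P(hPTH)))`
  let φ'P : End W := FreeAlgebra.lift k hPTH P
  have hSP : FreeAlgebra.lift k S P =
      (groupCohomology.map (MonoidHom.id Γ) (A := hKerRep W 0) (B := hKerRep W 0)
        (φZ W φ'P 0) q).hom :=
    (algHom_freeAlgebra_lift ((cohomologyMapAlgHom (hKerRep W 0) q).comp (φZAlgHom W 0))
      hPTH S (fun j => rfl) P).symm
  -- the values `N ≃ (k/p^{t'})^{ULift (Fin d)}`
  let eN' : N ≃ₗ[k] (ULift.{u} (Fin d) → modPow k (p : k) t') :=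
    eN.trans (LinearEquiv.funCongrLeft k (modPow k (p : k) t') Equiv.ulift)
  -- the data of `W` for `toLevelTwist'` and the nilpotence theorem
  let ρ₁ : Representation k Γ N := 1
  have hc₁ : ∀ (γ : Γ) (h : L ⧸ (T.level r).subgroupOf L), Commute (ρ₁ γ) (σ h) := commute_one σ
  let gL' : J → End (coeffRep ι (T.level r) ρ₁) := fun j => heckeRepHom ι (T.level r) ρ₁ (δ j)
  -- the vanishing hypothesis of the Hochschild–Serre nilpotence
  have hφ : ∀ b ≤ q, groupCohomology.map (MonoidHom.id Γ) (A := coeffRep ι (T.level r) ρ₁)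
      (B := coeffRep ι (T.level r) ρ₁) (toLevelTwist' ι hle ρ₁ σ hc₁ φ'P) b = 0 := by
    intro b hb
    have h1 : toLevelTwist' ι hle ρ₁ σ hc₁ φ'P = FreeAlgebra.lift k gL' P := by
      rw [← toLevelTwist'AlgHom_apply]
      exact algHom_freeAlgebra_lift (toLevelTwist'AlgHom ι hle ρ₁ σ hc₁) hPTH gL'
        (fun j => toLevelTwist'_heckeProdTwistHom ι hle ρ₁ σ hc₁ (hconj j) (hfin' j)) P
    have h2 : (groupCohomology.map (MonoidHom.id Γ) (A := coeffRep ι (T.level r) ρ₁)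
        (B := coeffRep ι (T.level r) ρ₁) (FreeAlgebra.lift k gL' P) b).hom =
        FreeAlgebra.lift k (fun j => heckeEnd ι (T.level r) ρ₁ (δ j) b) P :=
      algHom_freeAlgebra_lift (cohomologyMapAlgHom (coeffRep ι (T.level r) ρ₁) b) gL' _
        (fun j => rfl) P
    have h3 : FreeAlgebra.lift k (fun j => heckeEnd ι (T.level r) ρ₁ (δ j) b) P = 0 := by
      refine freeAlgebra_lift_heckeEnd_one_eq_zero ι (T.level r) _ δ b P ?_
      refine ArithmeticQuotient.freeAlgebra_lift_heckeEnd_eq_zero_of_equiv ι (T.level r) eN'.symm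
        δ b P ?_
      refine ArithmeticQuotient.freeAlgebra_lift_heckeEnd_pi_eq_zero ι (T.level r) δ b P ?_
      rw [← hP b hb]
      exact (algHom_freeAlgebra_lift (Pi.evalAlgHom k
        (fun z : TowerIndex => Module.End k (towerCohomology k ι T (p : k) z.1 z.2.1 z.2.2))
          (b, r, t'))
        (fun j => towerHeckeFamily k ι T (p : k) (δ j)) _ (fun j => rfl) P).symm
    rw [h1]
    apply ModuleCat.hom_ext
    rw [h2, h3, ModuleCat.hom_zero]
  have hnil := pow_succ_map_φZ_levelProdTwist_eq_zero ι hle ρ₁ σ hc₁ φ'P q hφ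
  rw [hSP]
  exact hnil

end TwistedQuotient

end Literature.NumberTheory.Automorphic
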